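import Literature.NumberTheory.Automorphic.SubgroupIndexDevissage
import Literature.NumberTheory.Automorphic.HermitianLatticesLocal
import HarnessLib

/-!
# The residue arithmetic of an unramified conjugation datum: the trace-zero lattice `{x ∈ 𝒪 : x + σx = 0}` and the
# `σ`-fixed lattice `{x ∈ 𝒪 : σx = x}` both have filtration quotients of order `√q`, and `q = #𝓀` is a perfect square
# (Serre, Corps locaux V §2; the trace-zero line `E⁰` of Rogawski §1.10)

Topic `NumberTheory/Automorphic`; namespace `Literature.NumberTheory.Automorphic.HermitianLattice` (lane `lit-hodgefound`,
Track 2 foundations; seat `lit-hodgefound-p11`, generation 46, row g46-#1).  THEOREMS ONLY: no definition, no named fact, no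
instance, no notation.  First step of the EVALUATION of the modulus index `[K_P : t_λ K_P t_λ⁻¹]` of the unramified unitary
groups `U(σ, J₀)` in relative rank one (`HyperspecialUnitarySatakeIsomorphismRankOne` leaves it as an index): the root groups of
`U(2)`, `U(3)` are coordinatised by `K` and by the TRACE-ZERO LINE `K⁰ = {x : x + σ x = 0}` (Rogawski's `E⁰`), so besides the
count `[𝒪 : ϖ^k 𝒪] = q^k` of `SubgroupIndexDevissage` (g45-#1) one needs the count `[𝒪⁰ : ϖ^k 𝒪⁰]` for `𝒪⁰ = 𝒪 ∩ K⁰`.  It is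
`(√q)^k`, and `q` is a square.  Everything is derived from the two axioms (trace) and `σ ≠ id` of an
`UnramifiedLocalConjDatum σ ϖ`, WITHOUT residue-field maps: only additive subgroups of `K` and their indices occur.

## The mathematics

`K` a field with `Valued K ℤᵐ⁰`, `hd : UnramifiedLocalConjDatum σ ϖ` (`σ` an involution preserving `v`, `ϖ` a `σ`-fixed
uniformiser, (trace) `t + σ t = 1` for some integral `t`), `σ ≠ id`, `𝓀 = 𝓀[K]` finite of order `q`.  Write
`B_γ = {v ≤ γ}`, `L_γ = B_γ ∩ ker(1 + σ)` (trace-zero ball), `F_γ = B_γ ∩ ker(1 - σ)` (`σ`-fixed ball).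

1. (§1) `σ ≠ id` gives a UNIT `ξ` with `σ ξ = -ξ` (`exists_v_eq_one_and_map_eq_neg`): for `σ x ≠ x`, `y = x - σ x ≠ 0` has
   `σ y = -y`, and `ξ = ϖ^{log v(y)} y`.  Hence `ξ · F_γ = L_γ` (`map_mulLeft_leAddSubgroup_inf_ker_sub`) and the two
   filtrations have the same indices (`relIndex_inf_ker_add_eq_relIndex_inf_ker_sub`).
2. (§2) (trace) makes `T⁻ = id - σ : B_γ → L_γ` SURJECTIVE (`y ∈ L_γ ⇒ y = (yt) - σ(yt)`; `map_sub_leAddSubgroup`) with kernel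
   `F`, and reading the exact sequence `0 → F → B → L → 0` modulo a smaller ball: for `γ' ≤ γ`,
   `(T⁻)⁻¹(L_{γ'}) ∩ B_γ = F_γ + B_{γ'}` (`comap_sub_inf_leAddSubgroup`), whence
   **`[B_γ : B_{γ'}] = [L_γ : L_{γ'}] · [F_γ : F_{γ'}]`** (`relIndex_leAddSubgroup_eq_mul`).
3. (§3) With `[B_0 : B_{-1}] = q` (g45-#1) and 1.: **`q = [L_0 : L_{-1}]²`** (`relIndex_traceZero_sq`), so `q` is a perfect square,
   `√q := Nat.sqrt q` satisfies `√q · √q = q` (`sqrt_card_residueField_mul_self`), and scaling by powers of the `σ`-fixed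
   uniformiser, **`[L_a : L_b] = [F_a : F_b] = (√q)^{(a-b)⁺}`** for all `a, b ∈ ℤ` (`relIndex_leAddSubgroup_inf_ker_add_exp`,
   `relIndex_leAddSubgroup_inf_ker_sub_exp`); in particular `[L_a : L_{a-2k}] = q^k`.  For `K = E_w ⊃ F_v` an unramified
   quadratic extension of local fields these are `q_E = q_F²`, `[𝒪_F : 𝔭_F^k] = q_F^k`, `[𝒪_E⁰ : ϖ^k𝒪_E⁰] = q_F^k`
   (Serre V §2: `e = 1`, `f = 2`, the trace is surjective).  Copies inside the subgroup `K⁰` (for transport along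
   one-parameter subgroups `Multiplicative K⁰ →* U(σ, J₀)`) close the file.

## What is formalised (theorems only)

* §1 `mem_ker_id_add_iff`, `mem_ker_id_sub_iff`, **`exists_v_eq_one_and_map_eq_neg`**, `map_mulLeft_leAddSubgroup_inf_ker_add`
  (`c·L_γ = L_{v(c)γ}` for `σ c = c`), `map_mulLeft_leAddSubgroup_inf_ker_sub` (`ξ·F_γ = L_{v(ξ)γ}` for `σ ξ = -ξ`),
  `map_mulLeft_leAddSubgroup_inf_ker_sub'` (`c·F_γ = F_{v(c)γ}`), **`relIndex_inf_ker_add_eq_relIndex_inf_ker_sub`**.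
* §2 `v_sub_map_le`, **`map_sub_leAddSubgroup`** (`(id - σ)(B_γ) = L_γ`), **`comap_sub_inf_leAddSubgroup`**,
  **`relIndex_leAddSubgroup_eq_mul`**.
* §3 **`relIndex_traceZero_sq`**, **`sqrt_card_residueField_mul_self`**, `relIndex_leAddSubgroup_inf_ker_add_zero_neg_one`,
  `relIndex_leAddSubgroup_inf_ker_add_neg_natCast`, **`relIndex_leAddSubgroup_inf_ker_add_exp`**,
  **`relIndex_leAddSubgroup_inf_ker_sub_exp`**, `relIndex_leAddSubgroup_inf_ker_add_exp_sub_two_mul`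
  (`[L_a : L_{a-2k}] = q^k`), `relIndex_leAddSubgroup_inf_ker_add_exp_ne_zero`; §4 copies in `K⁰`:
  `addSubgroupOf_inf_ker_add`, **`relIndex_addSubgroupOf_ker_add_leAddSubgroup_exp`**,
  **`relIndex_toSubgroup_addSubgroupOf_ker_add_leAddSubgroup_exp`**.

## References
* [Serre1979] J.-P. Serre, *Local Fields*, GTM 67 (1979), Ch. V §2 (unramified extensions: `e = 1`, the residue extension
  is separable of degree `f`, the trace `𝒪_L → 𝒪_K` is surjective), Ch. II §3 Prop. 5.
* [Jacobowitz1962] R. Jacobowitz, *Hermitian forms over local fields*, Amer. J. Math. 84 (1962), §7 (the unramified case).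
* [Rogawski1990] J. D. Rogawski, *Automorphic Representations of Unitary Groups in Three Variables*, Ann. of Math. Stud. 123
  (1990), §1.10 p. 14 (the trace-zero line `E⁰`, `n(w) = u(0, w)`, `w ∈ E⁰`).
* [CartierCorvallis1979] P. Cartier, *Representations of 𝔭-adic groups: a survey*, PSPM 33.1 (1979), §I.3 (indices of
  commensurable compact open subgroups).
-/

noncomputable section

open scoped Valued WithZero Pointwise

namespace Literature.NumberTheory.Automorphic.HermitianLattice

open Literature.NumberTheory.Automorphic.CartanUnique Literature.NumberTheory.Automorphic

variable {K : Type*} [Field K] [Valued K ℤᵐ⁰] {σ : K →+* K} {ϖ : K}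

/-! ## §1 The trace-zero and the fixed sublattices; the anti-invariant unit -/

omit [Valued K ℤᵐ⁰] in
/-- `x ∈ ker(id + σ) ↔ x + σ x = 0` (the trace-zero line `K⁰`). [cite: Rogawski1990, §1.10 p. 14] -/
theorem mem_ker_id_add_iff (x : K) : x ∈ (AddMonoidHom.id K + σ.toAddMonoidHom).ker ↔ x + σ x = 0 := Iff.rfl

omit [Valued K ℤᵐ⁰] in
/-- `x ∈ ker(id - σ) ↔ σ x = x` (the fixed field `K^σ`, as an additive subgroup). [cite: Serre1979, Ch. V §2] -/
theorem mem_ker_id_sub_iff (x : K) : x ∈ (AddMonoidHom.id K - σ.toAddMonoidHom).ker ↔ σ x = x := by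
  rw [AddMonoidHom.mem_ker, AddMonoidHom.sub_apply, sub_eq_zero, eq_comm]
  rfl

omit [Valued K ℤᵐ⁰] in
/-- `(id - σ) x = x - σ x`. [cite: Serre1979, Ch. V §2] -/
theorem id_sub_apply (x : K) : (AddMonoidHom.id K - σ.toAddMonoidHom) x = x - σ x := rfl

namespace UnramifiedLocalConjDatum

/-- **A unit of trace zero**: if `σ ≠ id` there is `ξ` with `v ξ = 1` and `σ ξ = -ξ` (for `σ x ≠ x` the element
`y = x - σ x ≠ 0` has `σ y = -y`; rescale by the `σ`-fixed uniformiser).  In the unramified quadratic situation `ξ` is a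
unit generator of the trace-zero line `E⁰ = F ξ`. [cite: Serre1979, Ch. V §2] [cite: Rogawski1990, §1.10 p. 14] -/
theorem exists_v_eq_one_and_map_eq_neg (hd : UnramifiedLocalConjDatum σ ϖ) (hσ : ∃ x : K, σ x ≠ x) :
    ∃ ξ : K, Valued.v ξ = 1 ∧ σ ξ = -ξ := by
  obtain ⟨x, hx⟩ := hσ
  set y : K := x - σ x with hy
  have hy0 : y ≠ 0 := sub_ne_zero.2 (Ne.symm hx)
  have hσy : σ y = -y := by rw [hy, map_sub, hd.σσ, neg_sub]
  have hvy : Valued.v y ≠ 0 := (Valuation.ne_zero_iff _).2 hy0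
  obtain ⟨k, hk⟩ : ∃ k : ℤ, Valued.v y = WithZero.exp k := ⟨_, (WithZero.exp_log hvy).symm⟩
  refine ⟨ϖ ^ k * y, ?_, ?_⟩
  · rw [map_mul, v_uniformizer_zpow hd.vϖ, hk, ← WithZero.exp_add, neg_add_cancel, WithZero.exp_zero]
  · rw [map_mul, map_zpow₀, hd.σϖ, hσy, mul_neg]

omit [Valued K ℤᵐ⁰] in
/-- For `σ c = c`: `x + σ x = 0 → c x + σ (c x) = 0`. [cite: Serre1979, Ch. V §2] -/
private theorem mul_mem_ker_id_add {c x : K} (hc : σ c = c) (hx : x + σ x = 0) : c * x + σ (c * x) = 0 := by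
  rw [map_mul, hc, ← mul_add, hx, mul_zero]

/-- **Scaling the trace-zero balls by a `σ`-fixed element**: `c · L_γ = L_{v(c)γ}` for `σ c = c`, `c ≠ 0`
(`L_γ = {v ≤ γ} ∩ ker(id + σ)`; e.g. `c = ϖ^k`). [cite: Serre1979, Ch. II §3 Prop. 5] -/
theorem map_mulLeft_leAddSubgroup_inf_ker_add (hd : UnramifiedLocalConjDatum σ ϖ) {c : K} (hc : σ c = c) (hc0 : c ≠ 0)
    (γ : ℤᵐ⁰) :
    ((Valued.v : Valuation K ℤᵐ⁰).leAddSubgroup γ ⊓ (AddMonoidHom.id K + σ.toAddMonoidHom).ker).map (AddMonoidHom.mulLeft c) =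
      (Valued.v : Valuation K ℤᵐ⁰).leAddSubgroup (Valued.v c * γ) ⊓ (AddMonoidHom.id K + σ.toAddMonoidHom).ker := by
  have _ := hd.σσ
  ext y
  simp only [AddSubgroup.mem_map, AddSubgroup.mem_inf, Valuation.mem_leAddSubgroup_iff, AddMonoidHom.coe_mulLeft,
    mem_ker_id_add_iff]
  constructor
  · rintro ⟨x, ⟨hx, hxσ⟩, rfl⟩
    exact ⟨by rw [map_mul]; exact mul_le_mul_right hx _, mul_mem_ker_id_add hc hxσ⟩
  · rintro ⟨hy, hyσ⟩
    have hvc : Valued.v c ≠ 0 := (Valuation.ne_zero_iff _).2 hc0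
    refine ⟨c⁻¹ * y, ⟨?_, ?_⟩, by rw [mul_inv_cancel_left₀ hc0]⟩
    · rw [map_mul, map_inv₀]
      calc (Valued.v c)⁻¹ * Valued.v y ≤ (Valued.v c)⁻¹ * (Valued.v c * γ) := mul_le_mul_right hy _
        _ = γ := by rw [inv_mul_cancel_left₀ hvc]
    · have hc' : σ c⁻¹ = c⁻¹ := by rw [map_inv₀, hc]
      exact mul_mem_ker_id_add hc' hyσ

/-- **Twisting the fixed balls into the trace-zero balls**: `ξ · F_γ = L_{v(ξ)γ}` for `σ ξ = -ξ`, `ξ ≠ 0`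
(`F_γ = {v ≤ γ} ∩ ker(id - σ)`: `σ(ξ x) = -ξ x` iff `σ x = x`). [cite: Serre1979, Ch. V §2] [cite: Rogawski1990, §1.10 p. 14] -/
theorem map_mulLeft_leAddSubgroup_inf_ker_sub (hd : UnramifiedLocalConjDatum σ ϖ) {ξ : K} (hξ : σ ξ = -ξ) (hξ0 : ξ ≠ 0)
    (γ : ℤᵐ⁰) :
    ((Valued.v : Valuation K ℤᵐ⁰).leAddSubgroup γ ⊓ (AddMonoidHom.id K - σ.toAddMonoidHom).ker).map (AddMonoidHom.mulLeft ξ) =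
      (Valued.v : Valuation K ℤᵐ⁰).leAddSubgroup (Valued.v ξ * γ) ⊓ (AddMonoidHom.id K + σ.toAddMonoidHom).ker := by
  have _ := hd.σσ
  ext y
  simp only [AddSubgroup.mem_map, AddSubgroup.mem_inf, Valuation.mem_leAddSubgroup_iff, AddMonoidHom.coe_mulLeft,
    mem_ker_id_add_iff, mem_ker_id_sub_iff]
  constructor
  · rintro ⟨x, ⟨hx, hxσ⟩, rfl⟩
    refine ⟨by rw [map_mul]; exact mul_le_mul_right hx _, ?_⟩
    rw [map_mul, hξ, hxσ, neg_mul, add_neg_cancel]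
  · rintro ⟨hy, hyσ⟩
    have hvξ : Valued.v ξ ≠ 0 := (Valuation.ne_zero_iff _).2 hξ0
    refine ⟨ξ⁻¹ * y, ⟨?_, ?_⟩, by rw [mul_inv_cancel_left₀ hξ0]⟩
    · rw [map_mul, map_inv₀]
      calc (Valued.v ξ)⁻¹ * Valued.v y ≤ (Valued.v ξ)⁻¹ * (Valued.v ξ * γ) := mul_le_mul_right hy _
        _ = γ := by rw [inv_mul_cancel_left₀ hvξ]
    · have hyσ' : σ y = -y := eq_neg_of_add_eq_zero_right hyσ
      rw [map_mul, map_inv₀, hξ, hyσ', inv_neg, neg_mul_neg]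

/-- **Scaling the fixed balls by a `σ`-fixed element**: `c · F_γ = F_{v(c)γ}` for `σ c = c`, `c ≠ 0`.
[cite: Serre1979, Ch. II §3 Prop. 5] -/
theorem map_mulLeft_leAddSubgroup_inf_ker_sub' (hd : UnramifiedLocalConjDatum σ ϖ) {c : K} (hc : σ c = c) (hc0 : c ≠ 0)
    (γ : ℤᵐ⁰) :
    ((Valued.v : Valuation K ℤᵐ⁰).leAddSubgroup γ ⊓ (AddMonoidHom.id K - σ.toAddMonoidHom).ker).map (AddMonoidHom.mulLeft c) =
      (Valued.v : Valuation K ℤᵐ⁰).leAddSubgroup (Valued.v c * γ) ⊓ (AddMonoidHom.id K - σ.toAddMonoidHom).ker := by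
  have _ := hd.σσ
  ext y
  simp only [AddSubgroup.mem_map, AddSubgroup.mem_inf, Valuation.mem_leAddSubgroup_iff, AddMonoidHom.coe_mulLeft,
    mem_ker_id_sub_iff]
  constructor
  · rintro ⟨x, ⟨hx, hxσ⟩, rfl⟩
    exact ⟨by rw [map_mul]; exact mul_le_mul_right hx _, by rw [map_mul, hc, hxσ]⟩
  · rintro ⟨hy, hyσ⟩
    have hvc : Valued.v c ≠ 0 := (Valuation.ne_zero_iff _).2 hc0
    refine ⟨c⁻¹ * y, ⟨?_, ?_⟩, by rw [mul_inv_cancel_left₀ hc0]⟩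
    · rw [map_mul, map_inv₀]
      calc (Valued.v c)⁻¹ * Valued.v y ≤ (Valued.v c)⁻¹ * (Valued.v c * γ) := mul_le_mul_right hy _
        _ = γ := by rw [inv_mul_cancel_left₀ hvc]
    · rw [map_mul, map_inv₀, hc, hyσ]

/-- **The trace-zero and the fixed filtrations have the same indices**: `[L_γ : L_γ'] = [F_γ : F_γ']` when `σ ≠ id`
(multiplication by the unit `ξ` of §1 is an isomorphism `F_γ ≃ L_γ` for every `γ`). [cite: Serre1979, Ch. V §2]
[cite: Rogawski1990, §1.10 p. 14] -/
theorem relIndex_inf_ker_add_eq_relIndex_inf_ker_sub (hd : UnramifiedLocalConjDatum σ ϖ) (hσ : ∃ x : K, σ x ≠ x) (γ γ' : ℤᵐ⁰) :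
    ((Valued.v : Valuation K ℤᵐ⁰).leAddSubgroup γ' ⊓ (AddMonoidHom.id K + σ.toAddMonoidHom).ker).relIndex
        ((Valued.v : Valuation K ℤᵐ⁰).leAddSubgroup γ ⊓ (AddMonoidHom.id K + σ.toAddMonoidHom).ker) =
      ((Valued.v : Valuation K ℤᵐ⁰).leAddSubgroup γ' ⊓ (AddMonoidHom.id K - σ.toAddMonoidHom).ker).relIndex
        ((Valued.v : Valuation K ℤᵐ⁰).leAddSubgroup γ ⊓ (AddMonoidHom.id K - σ.toAddMonoidHom).ker) := by
  obtain ⟨ξ, hvξ, hσξ⟩ := hd.exists_v_eq_one_and_map_eq_neg hσ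
  have hξ0 : ξ ≠ 0 := fun h => by rw [h, map_zero] at hvξ; exact zero_ne_one hvξ
  have hinj : Function.Injective (AddMonoidHom.mulLeft ξ) := mul_right_injective₀ hξ0
  symm
  rw [← AddSubgroup.relIndex_map_map_of_injective _ _ hinj, hd.map_mulLeft_leAddSubgroup_inf_ker_sub hσξ hξ0,
    hd.map_mulLeft_leAddSubgroup_inf_ker_sub hσξ hξ0, hvξ, one_mul, one_mul]

/-! ## §2 The exact sequence `0 → F → 𝒪 → L → 0` (`x ↦ x - σ x`) and `[B_γ : B_γ'] = [L_γ : L_γ'] · [F_γ : F_γ']` -/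

/-- `v (x - σ x) ≤ γ` for `v x ≤ γ` (`σ` preserves `v`). [cite: Serre1979, Ch. V §2] -/
theorem v_sub_map_le (hd : UnramifiedLocalConjDatum σ ϖ) {x : K} {γ : ℤᵐ⁰} (hx : Valued.v x ≤ γ) : Valued.v (x - σ x) ≤ γ :=
  Valuation.map_sub_le _ hx (by rw [hd.vσ]; exact hx)

/-- **`(id - σ)({v ≤ γ}) = L_γ`**: `x - σ x` has trace zero and valuation `≤ v x`; conversely, with the integral `t` of trace
one from the (trace) axiom, every `y` of trace zero is `y = (y t) - σ (y t)` — the SURJECTIVITY of `𝒪 → 𝒪⁰`, `x ↦ x - σ x`,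
for an unramified datum. [cite: Serre1979, Ch. V §2] [cite: Jacobowitz1962, §7] -/
theorem map_sub_leAddSubgroup (hd : UnramifiedLocalConjDatum σ ϖ) (γ : ℤᵐ⁰) :
    ((Valued.v : Valuation K ℤᵐ⁰).leAddSubgroup γ).map (AddMonoidHom.id K - σ.toAddMonoidHom) =
      (Valued.v : Valuation K ℤᵐ⁰).leAddSubgroup γ ⊓ (AddMonoidHom.id K + σ.toAddMonoidHom).ker := by
  ext y
  simp only [AddSubgroup.mem_map, AddSubgroup.mem_inf, Valuation.mem_leAddSubgroup_iff, mem_ker_id_add_iff, id_sub_apply]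
  constructor
  · rintro ⟨x, hx, rfl⟩
    exact ⟨hd.v_sub_map_le hx, by rw [map_sub, hd.σσ]; ring⟩
  · rintro ⟨hy, hyσ⟩
    obtain ⟨t, ht, htσ⟩ := hd.trace
    refine ⟨y * t, ?_, ?_⟩
    · rw [map_mul, ← mul_one γ]
      exact mul_le_mul' hy ht
    · have hyσ' : σ y = -y := eq_neg_of_add_eq_zero_right hyσ
      rw [map_mul, hyσ']
      linear_combination y * htσ

/-- **The exact sequence read modulo a smaller ball**: for `γ' ≤ γ`,
`(id - σ)⁻¹(L_{γ'}) ∩ B_γ = F_γ + B_{γ'}` — if `x - σ x = y ∈ L_{γ'}` then `y = z - σ z` with `v z ≤ γ'` and `x - z` is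
`σ`-fixed. [cite: Serre1979, Ch. V §2] -/
theorem comap_sub_inf_leAddSubgroup (hd : UnramifiedLocalConjDatum σ ϖ) {γ γ' : ℤᵐ⁰} (hγ : γ' ≤ γ) :
    ((Valued.v : Valuation K ℤᵐ⁰).leAddSubgroup γ' ⊓ (AddMonoidHom.id K + σ.toAddMonoidHom).ker).comap
          (AddMonoidHom.id K - σ.toAddMonoidHom) ⊓ (Valued.v : Valuation K ℤᵐ⁰).leAddSubgroup γ =
      (Valued.v : Valuation K ℤᵐ⁰).leAddSubgroup γ ⊓ (AddMonoidHom.id K - σ.toAddMonoidHom).ker ⊔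
        (Valued.v : Valuation K ℤᵐ⁰).leAddSubgroup γ' := by
  refine le_antisymm (fun x hx => ?_) (sup_le (fun x hx => ?_) (fun x hx => ?_))
  · obtain ⟨hx, hxγ⟩ := AddSubgroup.mem_inf.1 hx
    rw [AddSubgroup.mem_comap, ← hd.map_sub_leAddSubgroup γ', AddSubgroup.mem_map] at hx
    obtain ⟨z, hz, hzx⟩ := hx
    rw [Valuation.mem_leAddSubgroup_iff] at hz hxγ
    -- `x = (x - z) + z` with `x - z` fixed
    have hfix : σ (x - z) = x - z := by
      have h : z - σ z = x - σ x := by rwa [id_sub_apply, id_sub_apply] at hzx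
      rw [map_sub]
      linear_combination h
    rw [show x = (x - z) + z by ring]
    refine AddSubgroup.add_mem_sup (AddSubgroup.mem_inf.2 ⟨?_, (mem_ker_id_sub_iff _).2 hfix⟩) ?_
    · rw [Valuation.mem_leAddSubgroup_iff]
      exact Valuation.map_sub_le _ hxγ (hz.trans hγ)
    · rw [Valuation.mem_leAddSubgroup_iff]
      exact hz
  · obtain ⟨hxγ, hxσ⟩ := AddSubgroup.mem_inf.1 hx
    rw [mem_ker_id_sub_iff] at hxσ
    refine AddSubgroup.mem_inf.2 ⟨?_, hxγ⟩
    rw [AddSubgroup.mem_comap, id_sub_apply, hxσ, sub_self]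
    exact AddSubgroup.zero_mem _
  · refine AddSubgroup.mem_inf.2 ⟨?_, Valuation.leAddSubgroup_monotone _ hγ hx⟩
    rw [AddSubgroup.mem_comap, ← hd.map_sub_leAddSubgroup γ']
    exact AddSubgroup.mem_map_of_mem _ hx

/-- **`[B_γ : B_{γ'}] = [L_γ : L_{γ'}] · [F_γ : F_{γ'}]`** for `γ' ≤ γ` (`B = {v ≤ ·}`, `L = B ∩ ker(id + σ)`, `F = B ∩ ker(id - σ)`):
`[B_γ : F_γ + B_{γ'}] = [L_γ : L_{γ'}]` through `x ↦ x - σ x` and `[F_γ + B_{γ'} : B_{γ'}] = [F_γ : F_{γ'}]`.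
[cite: Serre1979, Ch. V §2] [cite: CartierCorvallis1979, §I.3] -/
theorem relIndex_leAddSubgroup_eq_mul (hd : UnramifiedLocalConjDatum σ ϖ) {γ γ' : ℤᵐ⁰} (hγ : γ' ≤ γ) :
    ((Valued.v : Valuation K ℤᵐ⁰).leAddSubgroup γ').relIndex ((Valued.v : Valuation K ℤᵐ⁰).leAddSubgroup γ) =
      ((Valued.v : Valuation K ℤᵐ⁰).leAddSubgroup γ' ⊓ (AddMonoidHom.id K + σ.toAddMonoidHom).ker).relIndex
          ((Valued.v : Valuation K ℤᵐ⁰).leAddSubgroup γ ⊓ (AddMonoidHom.id K + σ.toAddMonoidHom).ker) *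
        ((Valued.v : Valuation K ℤᵐ⁰).leAddSubgroup γ' ⊓ (AddMonoidHom.id K - σ.toAddMonoidHom).ker).relIndex
          ((Valued.v : Valuation K ℤᵐ⁰).leAddSubgroup γ ⊓ (AddMonoidHom.id K - σ.toAddMonoidHom).ker) := by
  set B := (Valued.v : Valuation K ℤᵐ⁰).leAddSubgroup γ with hB
  set B' := (Valued.v : Valuation K ℤᵐ⁰).leAddSubgroup γ' with hB'
  set Lp := (AddMonoidHom.id K + σ.toAddMonoidHom).ker with hLp
  set Fx := (AddMonoidHom.id K - σ.toAddMonoidHom).ker with hFx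
  set M := B ⊓ Fx ⊔ B' with hM
  have hB'B : B' ≤ B := Valuation.leAddSubgroup_monotone _ hγ
  have hB'M : B' ≤ M := le_sup_right
  have hMB : M ≤ B := sup_le inf_le_left hB'B
  -- the middle factor through `x ↦ x - σ x`
  have h₁ : M.relIndex B = (B' ⊓ Lp).relIndex (B ⊓ Lp) := by
    rw [hM, ← hd.comap_sub_inf_leAddSubgroup hγ, AddSubgroup.inf_relIndex_right, AddSubgroup.relIndex_comap,
      hd.map_sub_leAddSubgroup γ]
  -- the lower factor
  have h₂ : B'.relIndex M = (B' ⊓ Fx).relIndex (B ⊓ Fx) := by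
    rw [hM, AddSubgroup.relIndex_sup_right, ← AddSubgroup.inf_relIndex_right]
    congr 1
    rw [inf_comm B Fx, ← inf_assoc, inf_eq_left.2 (inf_le_left.trans hB'B)]
  rw [← AddSubgroup.relIndex_mul_relIndex B' M B hB'M hMB, h₁, h₂, mul_comm]

/-! ## §3 `q` is a square; `[L_a : L_b] = [F_a : F_b] = (√q)^{(a-b)⁺}` -/

/-- **`q = [L_0 : L_{-1}]²`**: the residue cardinality `q = [𝒪 : ϖ𝒪]` is the square of the index `[𝒪⁰ : ϖ𝒪⁰]` of the
trace-zero lattice (§2 with `γ = 1`, `γ' = exp(-1)`, and §1). [cite: Serre1979, Ch. V §2 (for `E/F` unramified quadratic,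
`q_E = q_F²`)] [cite: Jacobowitz1962, §7] -/
theorem relIndex_traceZero_sq (hd : UnramifiedLocalConjDatum σ ϖ) (hσ : ∃ x : K, σ x ≠ x) [Finite 𝓀[K]] :
    ((Valued.v : Valuation K ℤᵐ⁰).leAddSubgroup (WithZero.exp (-1 : ℤ)) ⊓ (AddMonoidHom.id K + σ.toAddMonoidHom).ker).relIndex
        ((Valued.v : Valuation K ℤᵐ⁰).leAddSubgroup (WithZero.exp (0 : ℤ)) ⊓ (AddMonoidHom.id K + σ.toAddMonoidHom).ker) ^ 2 =
      Nat.card 𝓀[K] := by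
  have hle : WithZero.exp (-1 : ℤ) ≤ WithZero.exp (0 : ℤ) := WithZero.exp_le_exp.2 (by norm_num)
  have h := hd.relIndex_leAddSubgroup_eq_mul hle
  rw [← hd.relIndex_inf_ker_add_eq_relIndex_inf_ker_sub hσ, relIndex_leAddSubgroup_exp hd.vϖ,
    show (0 - (-1 : ℤ)).toNat = 1 by norm_num, pow_one] at h
  rw [sq, ← h]

/-- **`√q · √q = q`**: the residue cardinality of an unramified conjugation datum with `σ ≠ id` is a perfect square
(`√q := Nat.sqrt q`; for `K = E_w`, `√q = q_F`). [cite: Serre1979, Ch. V §2] -/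
theorem sqrt_card_residueField_mul_self (hd : UnramifiedLocalConjDatum σ ϖ) (hσ : ∃ x : K, σ x ≠ x) [Finite 𝓀[K]] :
    Nat.sqrt (Nat.card 𝓀[K]) * Nat.sqrt (Nat.card 𝓀[K]) = Nat.card 𝓀[K] := by
  rw [← hd.relIndex_traceZero_sq hσ, Nat.sqrt_eq', sq]

/-- **`[L_0 : L_{-1}] = √q`** (the trace-zero lattice modulo `ϖ` has `√q` elements). [cite: Serre1979, Ch. V §2] -/
theorem relIndex_leAddSubgroup_inf_ker_add_zero_neg_one (hd : UnramifiedLocalConjDatum σ ϖ) (hσ : ∃ x : K, σ x ≠ x) [Finite 𝓀[K]] :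
    ((Valued.v : Valuation K ℤᵐ⁰).leAddSubgroup (WithZero.exp (-1 : ℤ)) ⊓ (AddMonoidHom.id K + σ.toAddMonoidHom).ker).relIndex
        ((Valued.v : Valuation K ℤᵐ⁰).leAddSubgroup (WithZero.exp (0 : ℤ)) ⊓ (AddMonoidHom.id K + σ.toAddMonoidHom).ker) =
      Nat.sqrt (Nat.card 𝓀[K]) := by
  rw [← hd.relIndex_traceZero_sq hσ, Nat.sqrt_eq']

/-- **`[L_0 : L_{-k}] = (√q)^k`** (induction on `k`: `[L_{-k} : L_{-k-1}] = [L_0 : L_{-1}]` by scaling with `ϖ^k`).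
[cite: Serre1979, Ch. II §3 Prop. 5, Ch. V §2] -/
theorem relIndex_leAddSubgroup_inf_ker_add_neg_natCast (hd : UnramifiedLocalConjDatum σ ϖ) (hσ : ∃ x : K, σ x ≠ x) [Finite 𝓀[K]]
    (k : ℕ) :
    ((Valued.v : Valuation K ℤᵐ⁰).leAddSubgroup (WithZero.exp (-(k : ℤ))) ⊓ (AddMonoidHom.id K + σ.toAddMonoidHom).ker).relIndex
        ((Valued.v : Valuation K ℤᵐ⁰).leAddSubgroup (WithZero.exp (0 : ℤ)) ⊓ (AddMonoidHom.id K + σ.toAddMonoidHom).ker) =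
      Nat.sqrt (Nat.card 𝓀[K]) ^ k := by
  set Lp := (AddMonoidHom.id K + σ.toAddMonoidHom).ker with hLp
  induction k with
  | zero =>
    rw [pow_zero, Nat.cast_zero, neg_zero]
    exact AddSubgroup.relIndex_self _
  | succ k ih =>
    have hϖ0 := uniformizer_ne_zero hd.vϖ
    have hc : ϖ ^ (k : ℤ) ≠ 0 := zpow_ne_zero _ hϖ0
    have hσc : σ (ϖ ^ (k : ℤ)) = ϖ ^ (k : ℤ) := by rw [map_zpow₀, hd.σϖ]
    have hinj : Function.Injective (AddMonoidHom.mulLeft (ϖ ^ (k : ℤ))) := mul_right_injective₀ hc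
    -- the last step `[L_{-k} : L_{-(k+1)}] = [L_0 : L_{-1}]`
    have hstep : ((Valued.v : Valuation K ℤᵐ⁰).leAddSubgroup (WithZero.exp (-((k + 1 : ℕ) : ℤ))) ⊓ Lp).relIndex
        ((Valued.v : Valuation K ℤᵐ⁰).leAddSubgroup (WithZero.exp (-(k : ℤ))) ⊓ Lp) = Nat.sqrt (Nat.card 𝓀[K]) := by
      have h0 : ((Valued.v : Valuation K ℤᵐ⁰).leAddSubgroup (WithZero.exp (0 : ℤ)) ⊓ Lp).map (AddMonoidHom.mulLeft (ϖ ^ (k : ℤ))) =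
          (Valued.v : Valuation K ℤᵐ⁰).leAddSubgroup (WithZero.exp (-(k : ℤ))) ⊓ Lp := by
        rw [hLp, hd.map_mulLeft_leAddSubgroup_inf_ker_add hσc hc, v_uniformizer_zpow hd.vϖ, ← WithZero.exp_add, add_zero]
      have h1 : ((Valued.v : Valuation K ℤᵐ⁰).leAddSubgroup (WithZero.exp (-1 : ℤ)) ⊓ Lp).map (AddMonoidHom.mulLeft (ϖ ^ (k : ℤ))) =
          (Valued.v : Valuation K ℤᵐ⁰).leAddSubgroup (WithZero.exp (-((k + 1 : ℕ) : ℤ))) ⊓ Lp := by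
        rw [hLp, hd.map_mulLeft_leAddSubgroup_inf_ker_add hσc hc, v_uniformizer_zpow hd.vϖ, ← WithZero.exp_add]
        congr 3
        push_cast
        ring
      rw [← h0, ← h1, AddSubgroup.relIndex_map_map_of_injective _ _ hinj]
      exact hd.relIndex_leAddSubgroup_inf_ker_add_zero_neg_one hσ
    have hle₁ : (Valued.v : Valuation K ℤᵐ⁰).leAddSubgroup (WithZero.exp (-((k + 1 : ℕ) : ℤ))) ⊓ Lp ≤
        (Valued.v : Valuation K ℤᵐ⁰).leAddSubgroup (WithZero.exp (-(k : ℤ))) ⊓ Lp :=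
      inf_le_inf_right _ (Valuation.leAddSubgroup_monotone _ (WithZero.exp_le_exp.2 (by push_cast; omega)))
    have hle₂ : (Valued.v : Valuation K ℤᵐ⁰).leAddSubgroup (WithZero.exp (-(k : ℤ))) ⊓ Lp ≤
        (Valued.v : Valuation K ℤᵐ⁰).leAddSubgroup (WithZero.exp (0 : ℤ)) ⊓ Lp :=
      inf_le_inf_right _ (Valuation.leAddSubgroup_monotone _ (WithZero.exp_le_exp.2 (by omega)))
    rw [← AddSubgroup.relIndex_mul_relIndex _ _ _ hle₁ hle₂, hstep, ih, pow_succ, mul_comm]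

/-- **`[L_a : L_b] = (√q)^{(a-b)⁺}`** for all `a, b ∈ ℤ` (`L_c = {v ≤ exp c} ∩ ker(id + σ)`; scale `[L_0 : L_{b-a}]` by `ϖ^{-a}`;
`= 1` for `a ≤ b`). [cite: Serre1979, Ch. II §3 Prop. 5, Ch. V §2] [cite: CartierCorvallis1979, §I.3] -/
theorem relIndex_leAddSubgroup_inf_ker_add_exp (hd : UnramifiedLocalConjDatum σ ϖ) (hσ : ∃ x : K, σ x ≠ x) [Finite 𝓀[K]]
    (a b : ℤ) :
    ((Valued.v : Valuation K ℤᵐ⁰).leAddSubgroup (WithZero.exp b) ⊓ (AddMonoidHom.id K + σ.toAddMonoidHom).ker).relIndex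
        ((Valued.v : Valuation K ℤᵐ⁰).leAddSubgroup (WithZero.exp a) ⊓ (AddMonoidHom.id K + σ.toAddMonoidHom).ker) =
      Nat.sqrt (Nat.card 𝓀[K]) ^ (a - b).toNat := by
  set Lp := (AddMonoidHom.id K + σ.toAddMonoidHom).ker with hLp
  rcases le_or_gt b a with hba | hab
  · obtain ⟨k, hk⟩ := Int.eq_ofNat_of_zero_le (sub_nonneg.2 hba)
    have hϖ0 := uniformizer_ne_zero hd.vϖ
    have hc : ϖ ^ (-a) ≠ 0 := zpow_ne_zero _ hϖ0
    have hσc : σ (ϖ ^ (-a)) = ϖ ^ (-a) := by rw [map_zpow₀, hd.σϖ]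
    have hinj : Function.Injective (AddMonoidHom.mulLeft (ϖ ^ (-a))) := mul_right_injective₀ hc
    have h1 : ((Valued.v : Valuation K ℤᵐ⁰).leAddSubgroup (WithZero.exp (0 : ℤ)) ⊓ Lp).map (AddMonoidHom.mulLeft (ϖ ^ (-a))) =
        (Valued.v : Valuation K ℤᵐ⁰).leAddSubgroup (WithZero.exp a) ⊓ Lp := by
      rw [hLp, hd.map_mulLeft_leAddSubgroup_inf_ker_add hσc hc, v_uniformizer_zpow hd.vϖ, neg_neg, ← WithZero.exp_add, add_zero]
    have h2 : ((Valued.v : Valuation K ℤᵐ⁰).leAddSubgroup (WithZero.exp (-(k : ℤ))) ⊓ Lp).map (AddMonoidHom.mulLeft (ϖ ^ (-a))) =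
        (Valued.v : Valuation K ℤᵐ⁰).leAddSubgroup (WithZero.exp b) ⊓ Lp := by
      rw [hLp, hd.map_mulLeft_leAddSubgroup_inf_ker_add hσc hc, v_uniformizer_zpow hd.vϖ, neg_neg, ← WithZero.exp_add]
      congr 3
      omega
    rw [hk, Int.toNat_natCast, ← h1, ← h2, AddSubgroup.relIndex_map_map_of_injective _ _ hinj]
    exact hd.relIndex_leAddSubgroup_inf_ker_add_neg_natCast hσ k
  · rw [Int.toNat_of_nonpos (sub_nonpos.2 hab.le), pow_zero]
    exact AddSubgroup.relIndex_eq_one.2 (inf_le_inf_right _ (Valuation.leAddSubgroup_monotone _ (WithZero.exp_le_exp.2 hab.le)))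

/-- **`[F_a : F_b] = (√q)^{(a-b)⁺}`** for the `σ`-FIXED balls `F_c = {v ≤ exp c} ∩ ker(id - σ)` (for `K = E_w ⊃ F_v` unramified
quadratic: `[𝒪_F : 𝔭_F^k] = q_F^k`, `q_F = √q_E`). [cite: Serre1979, Ch. V §2, Ch. II §3 Prop. 5] -/
theorem relIndex_leAddSubgroup_inf_ker_sub_exp (hd : UnramifiedLocalConjDatum σ ϖ) (hσ : ∃ x : K, σ x ≠ x) [Finite 𝓀[K]]
    (a b : ℤ) :
    ((Valued.v : Valuation K ℤᵐ⁰).leAddSubgroup (WithZero.exp b) ⊓ (AddMonoidHom.id K - σ.toAddMonoidHom).ker).relIndex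
        ((Valued.v : Valuation K ℤᵐ⁰).leAddSubgroup (WithZero.exp a) ⊓ (AddMonoidHom.id K - σ.toAddMonoidHom).ker) =
      Nat.sqrt (Nat.card 𝓀[K]) ^ (a - b).toNat := by
  rw [← hd.relIndex_inf_ker_add_eq_relIndex_inf_ker_sub hσ, hd.relIndex_leAddSubgroup_inf_ker_add_exp hσ]

/-- **`[L_a : L_{a-2k}] = q^k`**: along EVEN steps the trace-zero filtration has the same indices as `[𝒪 : ϖ^k𝒪]` (this is the
form in which the root group `2α` of `U(3)` and the root group of `U(2)` enter the modulus). [cite: Serre1979, Ch. V §2]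
[cite: CartierCorvallis1979, §I.3] -/
theorem relIndex_leAddSubgroup_inf_ker_add_exp_sub_two_mul (hd : UnramifiedLocalConjDatum σ ϖ) (hσ : ∃ x : K, σ x ≠ x)
    [Finite 𝓀[K]] (a : ℤ) (k : ℕ) :
    ((Valued.v : Valuation K ℤᵐ⁰).leAddSubgroup (WithZero.exp (a - 2 * k)) ⊓ (AddMonoidHom.id K + σ.toAddMonoidHom).ker).relIndex
        ((Valued.v : Valuation K ℤᵐ⁰).leAddSubgroup (WithZero.exp a) ⊓ (AddMonoidHom.id K + σ.toAddMonoidHom).ker) =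
      Nat.card 𝓀[K] ^ k := by
  rw [hd.relIndex_leAddSubgroup_inf_ker_add_exp hσ, show (a - (a - 2 * (k : ℤ))).toNat = 2 * k by omega, pow_mul,
    sq, hd.sqrt_card_residueField_mul_self hσ]

/-- The indices `[L_a : L_b]` are non-zero. [cite: CartierCorvallis1979, §I.3] -/
theorem relIndex_leAddSubgroup_inf_ker_add_exp_ne_zero (hd : UnramifiedLocalConjDatum σ ϖ) (hσ : ∃ x : K, σ x ≠ x) [Finite 𝓀[K]]
    (a b : ℤ) :
    ((Valued.v : Valuation K ℤᵐ⁰).leAddSubgroup (WithZero.exp b) ⊓ (AddMonoidHom.id K + σ.toAddMonoidHom).ker).relIndex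
        ((Valued.v : Valuation K ℤᵐ⁰).leAddSubgroup (WithZero.exp a) ⊓ (AddMonoidHom.id K + σ.toAddMonoidHom).ker) ≠ 0 := by
  rw [hd.relIndex_leAddSubgroup_inf_ker_add_exp hσ]
  refine pow_ne_zero _ fun h => ?_
  have h' := hd.sqrt_card_residueField_mul_self hσ
  rw [h, zero_mul] at h'
  exact (Nat.card_pos (α := 𝓀[K])).ne' h'.symm

/-! ## §4 Copies inside the trace-zero line `K⁰ = ker(id + σ)` (for one-parameter subgroups `Multiplicative K⁰ →* G`) -/

omit [Valued K ℤᵐ⁰] in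
/-- Restricting a ball to `K⁰`: `(B ⊓ K⁰)|_{K⁰} = B|_{K⁰}`. [folklore] -/
private theorem addSubgroupOf_inf_ker_add (B : AddSubgroup K) :
    (B ⊓ (AddMonoidHom.id K + σ.toAddMonoidHom).ker).addSubgroupOf (AddMonoidHom.id K + σ.toAddMonoidHom).ker =
      B.addSubgroupOf (AddMonoidHom.id K + σ.toAddMonoidHom).ker := by
  ext x
  simp only [AddSubgroup.mem_addSubgroupOf, AddSubgroup.mem_inf, SetLike.coe_mem, and_true]

/-- **`[B_a|_{K⁰} : B_b|_{K⁰}] = (√q)^{(a-b)⁺}`** for the balls restricted to the additive group `K⁰ = ker(id + σ)`.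
[cite: Serre1979, Ch. V §2] [cite: CartierCorvallis1979, §I.3] -/
theorem relIndex_addSubgroupOf_ker_add_leAddSubgroup_exp (hd : UnramifiedLocalConjDatum σ ϖ) (hσ : ∃ x : K, σ x ≠ x)
    [Finite 𝓀[K]] (a b : ℤ) :
    (((Valued.v : Valuation K ℤᵐ⁰).leAddSubgroup (WithZero.exp b)).addSubgroupOf (AddMonoidHom.id K + σ.toAddMonoidHom).ker).relIndex
        (((Valued.v : Valuation K ℤᵐ⁰).leAddSubgroup (WithZero.exp a)).addSubgroupOf (AddMonoidHom.id K + σ.toAddMonoidHom).ker) =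
      Nat.sqrt (Nat.card 𝓀[K]) ^ (a - b).toNat := by
  rw [← addSubgroupOf_inf_ker_add, ← addSubgroupOf_inf_ker_add ((Valued.v : Valuation K ℤᵐ⁰).leAddSubgroup (WithZero.exp a)),
    AddSubgroup.relIndex_addSubgroupOf inf_le_right, hd.relIndex_leAddSubgroup_inf_ker_add_exp hσ]

/-- Multiplicative copy: the same for the corresponding subgroups of `Multiplicative K⁰`.
[cite: Serre1979, Ch. V §2] [cite: CartierCorvallis1979, §I.3] -/
theorem relIndex_toSubgroup_addSubgroupOf_ker_add_leAddSubgroup_exp (hd : UnramifiedLocalConjDatum σ ϖ) (hσ : ∃ x : K, σ x ≠ x)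
    [Finite 𝓀[K]] (a b : ℤ) :
    (AddSubgroup.toSubgroup
        (((Valued.v : Valuation K ℤᵐ⁰).leAddSubgroup (WithZero.exp b)).addSubgroupOf (AddMonoidHom.id K + σ.toAddMonoidHom).ker)).relIndex
        (AddSubgroup.toSubgroup
          (((Valued.v : Valuation K ℤᵐ⁰).leAddSubgroup (WithZero.exp a)).addSubgroupOf (AddMonoidHom.id K + σ.toAddMonoidHom).ker)) =
      Nat.sqrt (Nat.card 𝓀[K]) ^ (a - b).toNat := by
  rw [AddSubgroup.relIndex_toSubgroup, hd.relIndex_addSubgroupOf_ker_add_leAddSubgroup_exp hσ]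

end UnramifiedLocalConjDatum

end Literature.NumberTheory.Automorphic.HermitianLattice

end
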